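import Summits.Ventures.PercRepro.ProfilePointedCircuitClassesStarStarE

/-!
# PercRepro — `StarStar` HOLDS: THE IN–OUT INEQUALITY `in_4(e) ≤ out_5(e)` AT `ρ ≥ 8` IS UNCONDITIONAL
(p5, gen 41; `proofs/P5-GM1.md` §60)

The statement `StarStar` of `ProfilePointedCircuitClassesInOutLYM` (§59 ADDENDUM 4 (***)) is the count of part V
read in the dual: for a coloop-free matroid `N` of nullity `4`, the dual `N✶` has rank `4` and no loops
(`rk_dual_add_rk`, `dual_indep_iff_spanning_compl`), a `5`-set `S` with `E ∖ S` independent spans `N✶`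
(`dual_spanning_iff_indep_compl`), a set `Z` with `E ∖ Z` spanning `N` is independent in `N✶`, and a `5`-set `X` with
`E ∖ X` independent in `N` spans `N✶`.  So **`starStar_holds : StarStar α`**, and
**`inCount_four_le_outCount_five_of_eight_le`**: `in_4(e) ≤ out_5(e)` at every point of every coloop-free matroid with
`#E = ρ(E) + 4`, `ρ(E) ≥ 8` — `InOutBottomFour` at `ρ ≥ 8` on coloop-free ground sets, with no hypothesis left.
-/

open scoped Matroid

namespace PercRepro.Cogirth

open Finset ThmH Skew Shadow Profile

variable {α : Type} [DecidableEq α] {N : Matroid α} [N.Finite]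

section StarStarF

/-- In the dual, `ρ✶(Z) = #Z` iff `E ∖ Z` spans `N` (for `Z ⊆ E`). -/
theorem rk_dual_eq_card_iff {Z : Finset α} (hZ : Z ⊆ gr N) :
    rk (N✶) Z = Z.card ↔ rk N (gr N \ Z) = rk N (gr N) := by
  rw [← spanning_iff_rk_eq sdiff_subset, ← dual_indep_iff_spanning_compl hZ]
  constructor
  · intro h
    exact indep_of_rk_eq_card h
  · intro h
    exact rk_eq_card_of_indep h

/-- In the dual, `ρ✶(X) = ρ✶(E)` iff `E ∖ X` is independent in `N` (for `X ⊆ E`). -/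
theorem rk_dual_eq_rk_dual_gr_iff {X : Finset α} (hX : X ⊆ gr N) :
    rk (N✶) X = rk (N✶) (gr (N✶)) ↔ rk N (gr N \ X) = (gr N \ X).card := by
  rw [← spanning_iff_rk_eq (by rw [gr_dual]; exact hX), dual_spanning_iff_indep_compl hX]
  constructor
  · intro h
    exact rk_eq_card_of_indep h
  · intro h
    exact indep_of_rk_eq_card h

/-- **`StarStar` holds**: the count of part V in the dual `N✶`. -/
theorem starStar_holds : StarStar α := by
  intro N _ S Y hn hcf hS hS5 hSc hY hY3
  have hR : rk (N✶) (gr (N✶)) = 4 := by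
    rw [gr_dual]
    have := rk_dual_add_rk (M := N)
    omega
  have hll : ∀ x ∈ gr (N✶), rk (N✶) {x} = 1 := by
    intro x hx
    rw [gr_dual] at hx
    have h := (rk_dual_eq_card_iff (singleton_subset_iff.2 hx)).2 (by
      rw [sdiff_singleton_eq_erase]; exact hcf x hx)
    rw [h, card_singleton]
  have hSd : S ⊆ gr (N✶) := by rw [gr_dual]; exact hS
  have hSsp : rk (N✶) S = 4 := by
    rw [← hR]
    exact (rk_dual_eq_rk_dual_gr_iff hS).2 hSc
  have hYd : Y ⊆ gr (N✶) \ S := by rw [gr_dual]; exact hY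
  have hYg : Y ⊆ gr N := hY.trans sdiff_subset
  have h := one_add_three_mul_card_le_card_spanning_five hR hll hSd hS5 hSsp hYd hY3
  -- translate the three filters
  have e2 : (Y.powersetCard 2).filter (fun Z => rk (N✶) Z = 2) =
      (Y.powersetCard 2).filter (fun Z => rk N (gr N \ Z) = rk N (gr N)) := by
    apply filter_congr
    intro Z hZ
    rw [mem_powersetCard] at hZ
    rw [← rk_dual_eq_card_iff (hZ.1.trans hYg), hZ.2]
  have e3 : (Y.powersetCard 3).filter (fun Z => rk (N✶) Z = 3) =
      (Y.powersetCard 3).filter (fun Z => rk N (gr N \ Z) = rk N (gr N)) := by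
    apply filter_congr
    intro Z hZ
    rw [mem_powersetCard] at hZ
    rw [← rk_dual_eq_card_iff (hZ.1.trans hYg), hZ.2]
  have e5 : ((S ∪ Y).powersetCard 5).filter (fun X => rk (N✶) X = 4) =
      ((S ∪ Y).powersetCard 5).filter (fun X => rk N (gr N \ X) = (gr N \ X).card) := by
    apply filter_congr
    intro X hX
    rw [mem_powersetCard] at hX
    rw [← rk_dual_eq_rk_dual_gr_iff (hX.1.trans (union_subset hS hYg)), hR]
  rw [e2, e3, e5] at h
  exact h

/-- **`InOutBottomFour` AT `ρ ≥ 8` ON COLOOP-FREE GROUND SETS, UNCONDITIONAL**: on every coloop-free matroid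
with `#E = ρ(E) + 4` and `ρ(E) ≥ 8`, `in_4(e) ≤ out_5(e)` for every `e`. -/
theorem inCount_four_le_outCount_five_of_eight_le {e : α} (hn : (gr N).card = rk N (gr N) + 4)
    (hR : 8 ≤ rk N (gr N)) (hcf : ∀ x ∈ gr N, rk N ((gr N).erase x) = rk N (gr N)) :
    inCount N 4 e ≤ outCount N 5 e :=
  inCount_four_le_outCount_five_of_starStar starStar_holds hn hR hcf

end StarStarF

end PercRepro.Cogirth
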